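import Summits.Langlands.Langlands.Theses.ExteriorSquareAscent
import Literature.NumberTheory.Automorphic.HeckeLAnalyticPackage

/-!
# Stub `stub_glOnePackage` of line `Sketch` for crux stmt-Langlands-18054
(`Summit.Langlands.Langlands.Theses.ExteriorSquareAscent.ReducibleInducesSquare`)

Helper H2 of the `(2,2)` analytic stub of the skeleton: the analytic package of the partial Hecke
`L`-function `L^S(s, u) = partialPairL S (w ↦ {u(ϖ_w)}) (w ↦ {1}) s` of a Hecke character `u`
unitary at almost every place — multipliable and continuous non-zero on `Re s > 1`, a simple pole at
`s = 1` when `u(ϖ_w) = 1` a.e. (Hecke's pole of `ζ_F^S`), a finite non-zero limit at `s = 1`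
otherwise (Jacquet–Shalika (2.2) on `GL₁ × GL₁`, a THEOREM of the tree).  All the work is the
library theorem `Literature.NumberTheory.Automorphic.analyticPackage_glOne`
(`Literature/NumberTheory/Automorphic/HeckeLAnalyticPackage.lean`, landed with this stub); this file
is the registered wrapper.
-/

set_option linter.dupNamespace false -- `Summit.Langlands.Langlands` is the mandated namespace

noncomputable section

namespace Summit.Langlands.Langlands.Cruxes.ReducibleInducesSquare.Sketch

/-- **HELPER-STUB H2 — the analytic package of `L^S(s, u)` for a Hecke character unitary a.e.**
(`GL₁ × GL₁`, all THEOREMS of the tree: (2.1) `JacquetShalika1981_multipliable_partialPairL_repData_holds`,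
`continuousAt_and_ne_zero_partialPairL_repData`, Hecke's pole of `ζ_F^S` when `u(ϖ_w) = 1` a.e.
(`tendsto_sub_one_mul_partialPairL_one_one`), `JacquetShalika1981_partialPairL_boundary_repData_one_one`
otherwise); the wrapper of `Literature.NumberTheory.Automorphic.analyticPackage_glOne`.
[cite: ArthurClozelAMS120, Ch. 3 §2 (2.1)–(2.3)] [cite: NeukirchANT1999, Ch. VII Cor. (5.11) (ii)] -/
theorem stub_glOnePackage :
    ∀ (F : Type) [Field F] [NumberField F]
      (u : Literature.NumberTheory.GaloisRepresentations.HeckeCharacter F),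
      (∀ᶠ w : IsDedekindDomain.HeightOneSpectrum (NumberField.RingOfIntegers F) in Filter.cofinite,
        ‖u.valueAtUniformizer w‖ = 1) →
      ∃ S₀ : Set (IsDedekindDomain.HeightOneSpectrum (NumberField.RingOfIntegers F)), S₀.Finite ∧
        ∀ (S : Set (IsDedekindDomain.HeightOneSpectrum (NumberField.RingOfIntegers F))),
          S.Finite → S₀ ⊆ S →
          (∀ s : ℂ, 1 < s.re → Multipliable fun v :
              {v : IsDedekindDomain.HeightOneSpectrum (NumberField.RingOfIntegers F) // v ∉ S} =>
            ((Literature.NumberTheory.Automorphic.satakePairPolynomial {u.valueAtUniformizer v.1} {1}).eval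
              ((v.1.residueCard : ℂ) ^ (-s)))⁻¹) ∧
          (∀ s : ℂ, 1 < s.re →
            ContinuousAt (Literature.NumberTheory.Automorphic.partialPairL S
              (fun w => {u.valueAtUniformizer w}) (fun _ => {1})) s ∧
              Literature.NumberTheory.Automorphic.partialPairL S
                (fun w => {u.valueAtUniformizer w}) (fun _ => {1}) s ≠ 0) ∧
          ((∀ᶠ w : IsDedekindDomain.HeightOneSpectrum (NumberField.RingOfIntegers F) in Filter.cofinite,
              u.valueAtUniformizer w = 1) →
            ∃ c : ℂ, c ≠ 0 ∧ Filter.Tendsto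
              (fun s : ℂ => (s - 1) * Literature.NumberTheory.Automorphic.partialPairL S
                (fun w => {u.valueAtUniformizer w}) (fun _ => {1}) s)
              (nhdsWithin 1 {s : ℂ | 1 < s.re}) (nhds c)) ∧
          ((¬ ∀ᶠ w : IsDedekindDomain.HeightOneSpectrum (NumberField.RingOfIntegers F) in Filter.cofinite,
              u.valueAtUniformizer w = 1) →
            ∃ c : ℂ, c ≠ 0 ∧ Filter.Tendsto
              (Literature.NumberTheory.Automorphic.partialPairL S
                (fun w => {u.valueAtUniformizer w}) (fun _ => {1}))
              (nhdsWithin 1 {s : ℂ | 1 < s.re}) (nhds c)) :=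
  Literature.NumberTheory.Automorphic.analyticPackage_glOne

end Summit.Langlands.Langlands.Cruxes.ReducibleInducesSquare.Sketch

end
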